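import Summits.AtomisticToContinuum.Crystallization.Theorems.LoopTunnelDialDepthSep
import Summits.AtomisticToContinuum.Crystallization.Theorems.LoopTunnelDialContactLaw
import Summits.AtomisticToContinuum.Crystallization.Theorems.LoopTunnelDialContactFloor

/-!
# LoopTunnelDial — CONTACT BRIDGE: SHORT ⟸ HOT, the separation shortcut, and the proved rungs in the law's language (lens-5 generation 18; crux `PocketCase`, stmt-AtomisticToContinuum-27294)

Landing kit file 4/5 (land after files 1–3).  `shortCertified_of_contactHotAbove` (delete the compressed particle: gain `b − e⋆`),
`farCertified_of_deepSep_minSep_thin` (under `MinSepGS (3/4)` SHORT is vacuous and DEEP¾'s separation clause automatic), and RUNGS 1/2 of the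
contact dial (`ContactHot 0.712 (−2/25)` ⟹ `MinSepGS 0.712`; `ContactHot 0.716 (−7/10)` ⟹ `ContactHotAbove 0.716`).  All `[folklore]`; 0 sorry.
-/

noncomputable section

open scoped BigOperators Classical InnerProductSpace
open Literature.MathematicalPhysics.StatisticalMechanics
open Literature.MathematicalPhysics.StatisticalMechanics.Yuhjtman2015 (hLJ)
open Summit.AtomisticToContinuum.Crystallization.Theorems.GrainPercolationDialCrossCeiling (E3 ballChunk)
open Summit.AtomisticToContinuum.Crystallization.Theorems.ChargedEnergyGapNegative (eStar)
open Summit.AtomisticToContinuum.Crystallization.Theorems.LjLaminarWindowsSketch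
  (lennardJones_groundState_dist_ge_seven_tenths forceBalance_sum_deriv_eq_zero forceBalance_one_le_sum_hLJ hLJ' kF)
open Summit.AtomisticToContinuum.Crystallization.Theorems.LoopTunnelDialLocalSurgery (improvable_mono)
open Summit.AtomisticToContinuum.Crystallization.Theorems.LoopTunnelDialSieveCurrency
open Summit.AtomisticToContinuum.Crystallization.Theorems.LoopTunnelDialDepthSep
open Summit.AtomisticToContinuum.Crystallization.Theorems.LoopTunnelDialContactLaw
open Summit.AtomisticToContinuum.Crystallization.Theorems.LoopTunnelDialContactFloor

namespace Summit.AtomisticToContinuum.Crystallization.Theorems.LoopTunnelDialContactBridge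

variable {N : ℕ}

/-- **SHORT ⟸ the GS contact law above `e⋆` (PROVED):** delete the compressed particle of the short pair (`improvable_of_warmSite`,
`ΔN = −1`, radius `s + 9`, gain `b − e⋆`, `N₀ = 0`). -/
theorem shortCertified_of_contactHotGS {s b : ℝ} (hs : 0 ≤ s) (hb : eStar < b) (h : ContactHotGS (3 / 4) b) :
    ShortCertified s := by
  refine ⟨0, s + 9, b - eStar, by linarith, sub_pos.2 hb, fun N _ y hy hsd => ?_⟩
  obtain ⟨c, _, hns⟩ := hsd
  unfold SepNear at hns
  push Not at hns
  obtain ⟨k, l, hkl, hk, _, hd⟩ := hns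
  have hsite := h N y hy k l hkl hd
  exact ⟨c, improvable_of_warmSite hy.1 (by linarith) hk (by linarith)⟩

/-- **SHORT ⟸ HOT (PROVED)** — v7.1's third stub is discharged by the contact law. -/
theorem shortCertified_of_contactHotAbove {s : ℝ} (hs : 0 ≤ s) (h : ContactHotAbove (3 / 4)) : ShortCertified s := by
  obtain ⟨b, hb, h⟩ := h
  exact shortCertified_of_contactHotGS hs hb (contactHotGS_of_contactHot h)

/-- Under `MinSepGS (3/4)` SHORT is VACUOUS (PROVED). -/
theorem shortCertified_of_minSepGS (s : ℝ) (h : MinSepGS (3 / 4)) : ShortCertified s :=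
  ⟨0, 0, 1, le_rfl, one_pos, fun N _ y hy hsd => by
    obtain ⟨c, _, hns⟩ := hsd
    exact absurd (sepNear_of_forall (h N y hy) c) hns⟩

/-- Under `MinSepGS (3/4)` DEEP¾'s separation clause is automatic: no deep far matter in ground states at all (PROVED). -/
theorem not_deepFar_of_deepSep_minSep {r s : ℝ} (hD : DeepFarCanonSep r s) (hM : MinSepGS (3 / 4)) {y : Fin N → E3}
    (hy : IsGroundState lennardJones y) (c : Fin N) : ¬ DeepFar s y c :=
  fun hc => not_sepNear_of_isGroundState_deepFar hD hy hc (sepNear_of_forall (hM N y hy) c)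

/-- Under DEEP¾ and `MinSepGS (3/4)` every ground state is shallow. [folklore] -/
theorem shallowFar_of_deepSep_minSep {r s : ℝ} (hD : DeepFarCanonSep r s) (hM : MinSepGS (3 / 4)) {y : Fin N → E3}
    (hy : IsGroundState lennardJones y) : ShallowFar s y :=
  fun i _ => not_deepFar_of_deepSep_minSep hD hM hy i

/-- Past the second threshold the door is DEEP¾ ∧ THIN alone (PROVED). -/
theorem farCertified_of_deepSep_minSep_thin {r s : ℝ} (hD : DeepFarCanonSep r s) (hM : MinSepGS (3 / 4)) (hT : ThinCertified s) :
    FarCertified :=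
  farCertified_of_deepSep_short_thin hD (shortCertified_of_minSepGS s hM) hT

/-! ### The rungs of §18.5 in the language of the contact law (from the def-free `LoopTunnelDialContactFloor`) -/

/-- The law from a floor bound on `[7/10, ρ)`. [folklore] -/
theorem contactHot_of_floor {ρ B : ℝ} (hB : ∀ a : ℝ, 7 / 10 ≤ a → a < ρ → 3840 / 49 + hLJ a - 1 / 25 * hLJ' a ≤ B) :
    ContactHot ρ (-(1 / 12) * B) := by
  intro N y hy hsep k l hkl hlt hF
  have h1 := contactFloor_le_siteEnergy hy hsep hkl hF
  have h2 := hB _ (hsep k l hkl) hlt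
  have h3 : -(1 / 12) * B ≤ -(1 / 12) * (3840 / 49 + hLJ (dist (y k) (y l)) - 1 / 25 * hLJ' (dist (y k) (y l))) := by linarith
  exact h3.trans h1

/-- **RUNG 1 (PROVED, GS-free):** `ContactHot 0.712 (−2/25)`. [folklore] -/
theorem contactHot_rung1 : ContactHot (89 / 125) (-(2 / 25)) :=
  contactHot_mono le_rfl (by norm_num)
    (contactHot_of_floor (ρ := 89 / 125) (B := 24 / 25) fun a ha1 ha2 => contactFloor_le_rung1 ha1 ha2.le)

/-- **Every Lennard-Jones ground state is `0.712`-separated** (`MinSepGS (89/125)`; tree: `7/10`). [folklore] -/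
theorem minSepGS_rung1 : MinSepGS (89 / 125) := minSepGS_of_contactHot (by norm_num) contactHot_rung1

/-- **RUNG 2 (PROVED, GS-free):** `ContactHot 0.716 (−7/10)`. [folklore] -/
theorem contactHot_rung2 : ContactHot (179 / 250) (-(7 / 10)) :=
  contactHot_mono le_rfl (by norm_num)
    (contactHot_of_floor (ρ := 179 / 250) (B := 42 / 5) fun a ha1 ha2 => contactFloor_le_rung2 ha1 ha2.le)

/-- STUB 3's statement at `ρ = 0.716` (modulo the landed `e⋆ ≤ −0.711`, hub-unbuilt ⇒ hypothesis): `ContactHotAbove (179/250)`. [folklore] -/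
theorem contactHotAbove_rung2 (he : eStar ≤ -(711 / 1000)) : ContactHotAbove (179 / 250) :=
  contactHotAbove_of_lt (by linarith) contactHot_rung2

end Summit.AtomisticToContinuum.Crystallization.Theorems.LoopTunnelDialContactBridge

end
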